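import Summits.HodgeConjecture.CorCM.Census.OcticTwistScrewPrep
import Summits.HodgeConjecture.CorCM.Census.QuarticTwistScrew

/-!
# The octic twist `(ℤ/8 × B, (4,0))`, XXV: THE SCREW COLUMN (b) — screw types, the SHAPED reducing faces, their transport and existence

COR-CM (cell `pub-hodgecm2`), count-neutral kernel combinatorics by the binder seat b09 (gen 35; lane COINVARIANT-TWIST / OCTIC RECON, the
screw column), on top of part XXIV (`Census/OcticTwistScrewPrep.lean`), part XVII (`UCovers`, `oriented_tw`, `balanced_tw_iff`), parts I–IV
(`act`, `transl₂`, `transl₂_rel`, `transl₂_false_cface₀`, `transl₂_true_cface₀`, `transl₂_true_tens`, `pot`, `IsFace₂`) and the quartic files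
(`QuarticTwistScrew`: `exists_screw`; `QuarticTwistOrientation`: `IsMin`, `IsUpper`; `QuarticTwistSquares`: `L`, `Phi`, `L_tw`, `lee`;
`QuarticTwistCount`: `isRes_tw`, `tw_flip'`; `OcticTwistCoverSlices`: `plc_snd_ne`; `QuarticTwistOrientation`: `exists_orientedSquare`;
`QuarticTwistReduction`: `faceVec_cst_column`) BY NAME.  One bookkeeping definition (`Shaped`, a
disjunction of face shapes) + theorems; no certificate, no named fact, no `sorry`.
HONEST FRAMING: `HC_CM` is NOT proved, here or anywhere in the tree; nothing here is a period or a headline.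

* §1 SCREW TYPES (`tw (1,t) ψ = ψ`, `4 ∣ ord t`): `ψ (b + n•t) = ψ b − n`, every value is taken (`exists_apply_eq_of_screw`), `ψ` is BALANCED
  (every regime minimises its Lee potential, `balanced_of_screw`), `Φ ψ ≥ 4` (`four_le_Phi_of_screw`), hence screw types and their
  neighbours are non-residual; `8 ∣ ord τ → 4 ∣ ord (τ + τ)`.
* §2 **`Shaped N T`**: the reducing face of `N` through the pair type `T` has one of the five shapes of part XVII `exists_orel` — both
  coordinates small residual (nothing to reduce), an ORIENTED cross square in coordinate `0` or `1` (corners of smaller `Φ` with a common upper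
  end), or the COLUMN relation at a `2`-atom in coordinate `0` or `1` — and **`shaped_act`**: in a motion-stable `N` the shape is transported
  along the block (diagonal motions keep the coordinate, swap-twists exchange the coordinates; upper ends shift by the twist).
* §3 **`exists_orel'`** = part XVII `exists_orel` with the column relations at `2`-atoms made explicit (`column_rel₀_eq`, `column_rel₁_eq`)
  and the SHAPE of the chosen face exported (`Shaped N T` as soon as the relation lies in `N`).
All [folklore].

## References
* [Pohlmann1968] H. Pohlmann, Algebraic cycles on abelian varieties of complex multiplication type, Ann. of Math. 88 (1968), Thm 1.
-/

namespace Summit.HodgeConjecture.CorCM.Census.OcticTwist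

open Finset
open Summit.HodgeConjecture.CorCM.Census.QuarticTwist

variable (B : Type) [AddGroup B] [Fintype B] [DecidableEq B]

/-! ## §1 Screw types -/

omit [Fintype B] [DecidableEq B] in
/-- A screw type drops by one along its screw: `ψ (b + t) = ψ b − 1`. [folklore] -/
theorem screw_apply_add {t : B} {ψ : Ty B} (hψ : tw B (1, t) ψ = ψ) (b : B) : ψ (b + t) = ψ b - 1 := by
  have h := congrFun hψ b
  change ψ (b + t) + 1 = ψ b at h
  rw [← h, add_sub_cancel_right]

omit [Fintype B] [DecidableEq B] in
/-- Along `n` steps of the screw the value drops by `n`. [folklore] -/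
theorem screw_apply_add_nsmul {t : B} {ψ : Ty B} (hψ : tw B (1, t) ψ = ψ) (b : B) (n : ℕ) : ψ (b + n • t) = ψ b - n := by
  induction n with
  | zero => rw [zero_nsmul, add_zero, Nat.cast_zero, sub_zero]
  | succ n ih => rw [succ_nsmul, ← add_assoc, screw_apply_add B hψ, ih, Nat.cast_succ]; ring

omit [Fintype B] [DecidableEq B] in
/-- **A screw type takes every value** (on every coset of its screw). [folklore] -/
theorem exists_apply_eq_of_screw {t : B} {ψ : Ty B} (hψ : tw B (1, t) ψ = ψ) (b₀ : B) (x : ZMod 4) :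
    ∃ n : ℕ, n < 4 ∧ ψ (b₀ + n • t) = x := by
  refine ⟨(ψ b₀ - x).val, ZMod.val_lt _, ?_⟩
  rw [screw_apply_add_nsmul B hψ, ZMod.natCast_zmod_val]; ring

omit [DecidableEq B] in
/-- **Screw types are balanced**: every regime minimises the Lee potential. [folklore] -/
theorem balanced_of_screw {t : B} {ψ : Ty B} (hψ : tw B (1, t) ψ = ψ) (w : ZMod 4) : IsMin B w ψ := by
  have hstep : ∀ u : ZMod 4, L B u ψ = L B (u - 1) ψ := fun u => by
    conv_lhs => rw [← hψ]
    rw [L_tw]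
  have hall : ∀ u u' : ZMod 4, L B u ψ = L B u' ψ := by
    have h1 : ∀ u : ZMod 4, L B u ψ = L B 0 ψ := by
      intro u
      have key : ∀ u : ZMod 4, u = 0 ∨ u = 0 - 1 - 1 - 1 ∨ u = 0 - 1 - 1 ∨ u = 0 - 1 := by decide
      rcases key u with rfl | rfl | rfl | rfl
      · rfl
      · rw [← hstep, ← hstep, ← hstep]
      · rw [← hstep, ← hstep]
      · rw [← hstep]
    intro u u'; rw [h1 u, h1 u']
  obtain ⟨u, hu⟩ := exists_L_eq_Phi B ψ
  unfold QuarticTwist.IsMin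
  rw [hall w u, hu]

omit [DecidableEq B] in
/-- **A screw type has Lee potential at least `4`** (`4 ∣ ord t`, `t ≠ 0`): four consecutive columns of the screw carry the values
`x, x−1, x−2, x−3`. [folklore] -/
theorem four_le_Phi_of_screw {t : B} (h4 : 4 ∣ addOrderOf t) {ψ : Ty B} (hψ : tw B (1, t) ψ = ψ) : 4 ≤ Phi B ψ := by
  classical
  obtain ⟨b₀⟩ : Nonempty B := ⟨t⟩
  have hord : 4 ≤ addOrderOf t := Nat.le_of_dvd (addOrderOf_pos t) h4
  -- the four columns `b₀ + n•t`, `n < 4`, are distinct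
  let col : Fin 4 → B := fun n => b₀ + (n : ℕ) • t
  have hinj : Function.Injective col := by
    intro m n hmn
    have h : (m : ℕ) • t = (n : ℕ) • t := add_left_cancel hmn
    rw [nsmul_eq_nsmul_iff_modEq] at h
    have := Nat.ModEq.eq_of_lt_of_lt h (lt_of_lt_of_le m.2 hord) (lt_of_lt_of_le n.2 hord)
    exact Fin.ext this
  have hmin := balanced_of_screw B hψ 0
  unfold QuarticTwist.IsMin at hmin
  rw [← hmin]
  unfold L
  have hsub : (Finset.univ.image col) ⊆ (Finset.univ : Finset B) := Finset.subset_univ _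
  refine le_trans ?_ (Finset.sum_le_sum_of_subset hsub)
  rw [Finset.sum_image fun m _ n _ h => hinj h]
  have hval : ∀ n : Fin 4, lee (ψ (col n) - 0) = lee (ψ b₀ - (n : ℕ)) := fun n => by
    rw [sub_zero]; exact congrArg lee (screw_apply_add_nsmul B hψ b₀ n)
  rw [Finset.sum_congr rfl fun n _ => hval n]
  rw [Fin.sum_univ_four]
  show 4 ≤ lee (ψ b₀ - ((0 : ℕ) : ZMod 4)) + lee (ψ b₀ - ((1 : ℕ) : ZMod 4)) + lee (ψ b₀ - ((2 : ℕ) : ZMod 4)) + lee (ψ b₀ - ((3 : ℕ) : ZMod 4))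
  have key : ∀ x : ZMod 4, 4 ≤ lee (x - ((0 : ℕ) : ZMod 4)) + lee (x - ((1 : ℕ) : ZMod 4)) + lee (x - ((2 : ℕ) : ZMod 4))
      + lee (x - ((3 : ℕ) : ZMod 4)) := by decide
  exact key (ψ b₀)

omit [AddGroup B] in
/-- Residual types have Lee potential at most `2`. [folklore] -/
theorem Phi_le_two_of_isRes (h3 : 3 ≤ Fintype.card B) {s : Ty B} (hs : IsRes B s) : Phi B s ≤ 2 := by
  obtain ⟨u, b, k, rfl⟩ := hs
  rw [Phi_atom B h3]
  exact lee_le_two k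

omit [AddGroup B] in
/-- A type of Lee potential at least `3` is not residual. [folklore] -/
theorem not_isRes_of_three_le_Phi (h3 : 3 ≤ Fintype.card B) {s : Ty B} (hs : 3 ≤ Phi B s) : ¬ IsRes B s := fun h => by
  have := Phi_le_two_of_isRes B h3 h; omega

omit [Fintype B] [DecidableEq B] in
/-- `8 ∣ ord τ → 4 ∣ ord (τ + τ)` in a finite group. [folklore] -/
theorem four_dvd_addOrderOf_add_self [Finite B] {τ : B} (h8 : 8 ∣ addOrderOf τ) : 4 ∣ addOrderOf (τ + τ) := by
  rw [← two_nsmul, addOrderOf_nsmul]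
  obtain ⟨k, hk⟩ := h8
  rw [hk, show 8 * k = 2 * (4 * k) by ring, Nat.gcd_mul_right_left, Nat.mul_div_cancel_left _ (by norm_num : 0 < 2)]
  exact Dvd.intro k rfl

/-! ## §2 Shaped reducing faces and their transport -/

/-- **The shape of the reducing face through `T`** in `N`: (RR) both coordinates small residual; (S0)/(S1) an oriented cross square in
coordinate `0`/`1` — corners of smaller `Φ` with a common upper end `u`, `u` the upper end of the centre unless the centre is balanced;
(C0)/(C1) the column relation at a `2`-atom in coordinate `0`/`1`. [folklore] -/
def Shaped (N : Submodule ℤ (Ty₂ B → ℤ)) (T : Ty₂ B) : Prop :=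
  (IsRes B T.1 ∧ (¬ ∃ (u : ZMod 4) (b : B), T.1 = atom B u b 2) ∧ IsRes B T.2 ∧ ¬ ∃ (u : ZMod 4) (b : B), T.2 = atom B u b 2) ∨
  (∃ (u : ZMod 4) (p q : ZMod 2 × B), p.2 ≠ q.2 ∧ tens B (faceVec B T.1 p q) (Pi.single T.2 1) ∈ N ∧
    ((∀ w, IsMin B w T.1) ∨ IsUpper B u T.1) ∧
    (Phi B (QuarticTwist.flip B p T.1) < Phi B T.1 ∧ IsUpper B u (QuarticTwist.flip B p T.1)) ∧
    (Phi B (QuarticTwist.flip B q T.1) < Phi B T.1 ∧ IsUpper B u (QuarticTwist.flip B q T.1)) ∧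
    (Phi B (QuarticTwist.flip B q (QuarticTwist.flip B p T.1)) < Phi B T.1 ∧
      IsUpper B u (QuarticTwist.flip B q (QuarticTwist.flip B p T.1)))) ∨
  (∃ (u : ZMod 4) (p q : ZMod 2 × B), p.2 ≠ q.2 ∧ tens B (Pi.single T.1 1) (faceVec B T.2 p q) ∈ N ∧
    ((∀ w, IsMin B w T.2) ∨ IsUpper B u T.2) ∧
    (Phi B (QuarticTwist.flip B p T.2) < Phi B T.2 ∧ IsUpper B u (QuarticTwist.flip B p T.2)) ∧
    (Phi B (QuarticTwist.flip B q T.2) < Phi B T.2 ∧ IsUpper B u (QuarticTwist.flip B q T.2)) ∧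
    (Phi B (QuarticTwist.flip B q (QuarticTwist.flip B p T.2)) < Phi B T.2 ∧
      IsUpper B u (QuarticTwist.flip B q (QuarticTwist.flip B p T.2)))) ∨
  (∃ (u : ZMod 4) (b : B), T.1 = atom B u b 2 ∧
    (Pi.single T 1 - Pi.single (atom B u b (-1), T.2) 1 - Pi.single (atom B u b 1, T.2) 1 + Pi.single (cst B u, T.2) 1 : Ty₂ B → ℤ) ∈ N) ∨
  (∃ (u : ZMod 4) (b : B), T.2 = atom B u b 2 ∧
    (Pi.single T 1 - Pi.single (T.1, atom B u b (-1)) 1 - Pi.single (T.1, atom B u b 1) 1 + Pi.single (T.1, cst B u) 1 : Ty₂ B → ℤ) ∈ N)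

omit [Fintype B] in
/-- `2`-atoms are carried to `2`-atoms by twists (contrapositive form). [folklore] -/
theorem two_atom_of_tw {g : ZMod 4 × B} {s : Ty B} (h : ∃ (u : ZMod 4) (b : B), tw B g s = atom B u b 2) :
    ∃ (u : ZMod 4) (b : B), s = atom B u b 2 := by
  obtain ⟨u, b, hu⟩ := h
  refine ⟨u - g.1, b + g.2, ?_⟩
  have := congrArg (tw B (-g)) hu
  rw [tw_neg_tw, tw_atom] at this
  rw [this, Prod.fst_neg, Prod.snd_neg, sub_neg_eq_add, ← sub_eq_add_neg]

omit [Fintype B] in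
/-- Small-residual-ness of a coordinate is transported by twists. [folklore] -/
theorem smallRes_tw {s : Ty B} (hs : IsRes B s ∧ ¬ ∃ (u : ZMod 4) (b : B), s = atom B u b 2) (g : ZMod 4 × B) :
    IsRes B (tw B g s) ∧ ¬ ∃ (u : ZMod 4) (b : B), tw B g s = atom B u b 2 :=
  ⟨isRes_tw B hs.1 g, fun h => hs.2 (two_atom_of_tw B h)⟩

/-- **TRANSPORT OF SHAPES.**  In a motion-stable `N`, if the reducing face through `T` is shaped then so is the transported face through
`act e h T`. [folklore] -/
theorem shaped_act {N : Submodule ℤ (Ty₂ B → ℤ)} (hmot : ∀ v ∈ N, ∀ (e : Bool) (h : ZMod 4 × B), transl₂ B e h v ∈ N)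
    {T : Ty₂ B} (hT : Shaped B N T) (e : Bool) (h : ZMod 4 × B) : Shaped B N (act B e h T) := by
  obtain ⟨s, t⟩ := T
  have eF : ∀ x y : Ty B, act B false h (x, y) = (tw B h x, tw B h y) := fun x y => rfl
  have eT : ∀ x y : Ty B, act B true h (x, y) = (tw B (h + (1, 0)) y, tw B h x) := fun x y => by
    rw [act_true]; show (tw B h (tw B (1, 0) y), tw B h x) = _; rw [tw_tw]
  have aF := eF s t
  have aT := eT s t
  rcases hT with ⟨hs, hs2, ht, ht2⟩ | ⟨u, p, q, hpq, hf, hor, h1, h2, h12⟩ | ⟨u, p, q, hpq, hf, hor, h1, h2, h12⟩ |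
      ⟨u, b, hsb, hrel⟩ | ⟨u, b, htb, hrel⟩
  · -- (RR)
    cases e
    · rw [aF]; exact Or.inl ⟨(smallRes_tw B ⟨hs, hs2⟩ h).1, (smallRes_tw B ⟨hs, hs2⟩ h).2, (smallRes_tw B ⟨ht, ht2⟩ h).1,
        (smallRes_tw B ⟨ht, ht2⟩ h).2⟩
    · rw [aT]; exact Or.inl ⟨(smallRes_tw B ⟨ht, ht2⟩ _).1, (smallRes_tw B ⟨ht, ht2⟩ _).2, (smallRes_tw B ⟨hs, hs2⟩ h).1,
        (smallRes_tw B ⟨hs, hs2⟩ h).2⟩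
  · -- (S0)
    have hot := oriented_tw B h hor h1 h2 h12
    cases e
    · rw [aF]
      refine Or.inr (Or.inl ⟨u + h.1, plc B h p, plc B h q, plc_snd_ne B hpq, ?_, ?_, ?_, ?_, ?_⟩)
      · have hm := hmot _ hf false h
        rw [transl₂_false_cface₀] at hm
        exact hm
      · exact hot.1
      · exact hot.2.1
      · exact hot.2.2.1
      · exact hot.2.2.2
    · rw [aT]
      refine Or.inr (Or.inr (Or.inl ⟨u + h.1, plc B h p, plc B h q, plc_snd_ne B hpq, ?_, ?_, ?_, ?_, ?_⟩))
      · have hm := hmot _ hf true h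
        rw [transl₂_true_cface₀] at hm
        exact hm
      · exact hot.1
      · exact hot.2.1
      · exact hot.2.2.1
      · exact hot.2.2.2
  · -- (S1)
    cases e
    · rw [aF]
      have hot := oriented_tw B h hor h1 h2 h12
      refine Or.inr (Or.inr (Or.inl ⟨u + h.1, plc B h p, plc B h q, plc_snd_ne B hpq, ?_, ?_, ?_, ?_, ?_⟩))
      · have hm := hmot _ hf false h
        rw [transl₂_false_tens, transl_single, transl_faceVec] at hm
        exact hm
      · exact hot.1
      · exact hot.2.1
      · exact hot.2.2.1
      · exact hot.2.2.2
    · rw [aT]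
      have hot := oriented_tw B (h + (1, 0)) hor h1 h2 h12
      refine Or.inr (Or.inl ⟨u + (h + (1, 0)).1, plc B (h + (1, 0)) p, plc B (h + (1, 0)) q, plc_snd_ne B hpq, ?_, ?_, ?_, ?_, ?_⟩)
      · have hm := hmot _ hf true h
        rw [transl₂_true_tens, transl_single, transl_faceVec] at hm
        exact hm
      · exact hot.1
      · exact hot.2.1
      · exact hot.2.2.1
      · exact hot.2.2.2
  · -- (C0)
    simp only at hsb hrel
    subst hsb
    cases e
    · rw [aF, tw_atom]
      refine Or.inr (Or.inr (Or.inr (Or.inl ⟨u + h.1, b - h.2, rfl, ?_⟩)))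
      have hm := hmot _ hrel false h
      rw [transl₂_rel, eF, eF, eF, eF, tw_atom, tw_atom, tw_atom, tw_cst] at hm
      exact hm
    · rw [aT, tw_atom]
      refine Or.inr (Or.inr (Or.inr (Or.inr ⟨u + h.1, b - h.2, rfl, ?_⟩)))
      have hm := hmot _ hrel true h
      rw [transl₂_rel, eT, eT, eT, eT, tw_atom, tw_atom, tw_atom, tw_cst] at hm
      exact hm
  · -- (C1)
    simp only at htb hrel
    subst htb
    cases e
    · rw [aF, tw_atom]
      refine Or.inr (Or.inr (Or.inr (Or.inr ⟨u + h.1, b - h.2, rfl, ?_⟩)))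
      have hm := hmot _ hrel false h
      rw [transl₂_rel, eF, eF, eF, eF, tw_atom, tw_atom, tw_atom, tw_cst] at hm
      exact hm
    · rw [aT, tw_atom]
      refine Or.inr (Or.inr (Or.inr (Or.inl ⟨u + (h + (1, 0)).1, b - (h + (1, 0)).2, rfl, ?_⟩)))
      have hm := hmot _ hrel true h
      rw [transl₂_rel, eT, eT, eT, eT, tw_atom, tw_atom, tw_atom, tw_cst] at hm
      exact hm

/-! ## §3 Shaped reducing faces through every pair type of potential `≥ 2` -/

omit [AddGroup B] in
/-- The column relation at a `2`-atom in coordinate `0` is a coset face. [folklore] -/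
theorem column_rel₀_eq (u : ZMod 4) (b : B) (t : Ty B) :
    (Pi.single (atom B u b 2, t) 1 - Pi.single (atom B u b (-1), t) 1 - Pi.single (atom B u b 1, t) 1 + Pi.single (cst B u, t) 1 :
      Ty₂ B → ℤ) = tens B (faceVec B (cst B u) ((0 : ZMod 2), b) ((1 : ZMod 2), b)) (Pi.single t 1) := by
  rw [faceVec_cst_column, tens_add_left, tens_sub_left, tens_sub_left, ← single_eq_tens, ← single_eq_tens, ← single_eq_tens,
    ← single_eq_tens]
  rcases step_eq_or 0 u with h | h <;> rw [h]
  · rw [show -(1 : ZMod 4) = -1 from rfl]; abel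
  · rw [neg_neg]; abel

omit [AddGroup B] in
/-- The column relation at a `2`-atom in coordinate `1` is a coset face. [folklore] -/
theorem column_rel₁_eq (s : Ty B) (u : ZMod 4) (b : B) :
    (Pi.single (s, atom B u b 2) 1 - Pi.single (s, atom B u b (-1)) 1 - Pi.single (s, atom B u b 1) 1 + Pi.single (s, cst B u) 1 :
      Ty₂ B → ℤ) = tens B (Pi.single s 1) (faceVec B (cst B u) ((0 : ZMod 2), b) ((1 : ZMod 2), b)) := by
  rw [faceVec_cst_column, tens_add_right, tens_sub_right, tens_sub_right, ← single_eq_tens, ← single_eq_tens, ← single_eq_tens,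
    ← single_eq_tens]
  rcases step_eq_or 0 u with h | h <;> rw [h]
  · rw [show -(1 : ZMod 4) = -1 from rfl]; abel
  · rw [neg_neg]; abel

omit [AddGroup B] in
/-- **The reducing face through a type of potential `≥ 2`, with its SHAPE exported** (`|B| ≥ 3`): part XVII `exists_orel` with the column
relations explicit and the conclusion `Shaped N T` whenever the relation lies in `N`. [folklore] -/
theorem exists_orel' (h3 : 3 ≤ Fintype.card B) (T : Ty₂ B) (hT : 2 ≤ pot B T) :
    ∃ T₁ T₂ T₃ : Ty₂ B,
      IsFace₂ B (Pi.single T 1 - Pi.single T₁ 1 - Pi.single T₂ 1 + Pi.single T₃ 1 : Ty₂ B → ℤ) ∧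
      (pot B T₁ < pot B T ∧ pot B T₂ < pot B T ∧ pot B T₃ < pot B T) ∧
      (¬ IsRes B T.1 → ∃ (u : ZMod 4) (p q : ZMod 2 × B), p.2 ≠ q.2 ∧
        (Pi.single T 1 - Pi.single T₁ 1 - Pi.single T₂ 1 + Pi.single T₃ 1 : Ty₂ B → ℤ) = tens B (faceVec B T.1 p q) (Pi.single T.2 1) ∧
        ((∀ w, IsMin B w T.1) ∨ IsUpper B u T.1) ∧
        (Phi B (QuarticTwist.flip B p T.1) < Phi B T.1 ∧ IsUpper B u (QuarticTwist.flip B p T.1)) ∧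
        (Phi B (QuarticTwist.flip B q T.1) < Phi B T.1 ∧ IsUpper B u (QuarticTwist.flip B q T.1)) ∧
        (Phi B (QuarticTwist.flip B q (QuarticTwist.flip B p T.1)) < Phi B T.1 ∧
          IsUpper B u (QuarticTwist.flip B q (QuarticTwist.flip B p T.1)))) ∧
      (IsRes B T.1 → (¬ ∃ (u : ZMod 4) (b : B), T.1 = atom B u b 2) → ¬ IsRes B T.2 → ∃ (u : ZMod 4) (p q : ZMod 2 × B), p.2 ≠ q.2 ∧
        (Pi.single T 1 - Pi.single T₁ 1 - Pi.single T₂ 1 + Pi.single T₃ 1 : Ty₂ B → ℤ) = tens B (Pi.single T.1 1) (faceVec B T.2 p q) ∧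
        ((∀ w, IsMin B w T.2) ∨ IsUpper B u T.2) ∧
        (Phi B (QuarticTwist.flip B p T.2) < Phi B T.2 ∧ IsUpper B u (QuarticTwist.flip B p T.2)) ∧
        (Phi B (QuarticTwist.flip B q T.2) < Phi B T.2 ∧ IsUpper B u (QuarticTwist.flip B q T.2)) ∧
        (Phi B (QuarticTwist.flip B q (QuarticTwist.flip B p T.2)) < Phi B T.2 ∧
          IsUpper B u (QuarticTwist.flip B q (QuarticTwist.flip B p T.2)))) ∧
      (∀ (u : ZMod 4) (b : B) (k : ZMod 4) (u' : ZMod 4) (b' : B) (k' : ZMod 4), T = (atom B u b k, atom B u' b' k') →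
        (k = 1 ∨ k = -1) → (k' = 1 ∨ k' = -1) →
        (Pi.single T 1 - Pi.single T₁ 1 - Pi.single T₂ 1 + Pi.single T₃ 1 : Ty₂ B → ℤ) =
          tens B (Pi.single (atom B u b k) 1 - Pi.single (cst B u) 1) (Pi.single (atom B u' b' k') 1 - Pi.single (cst B u') 1)) ∧
      (∀ N : Submodule ℤ (Ty₂ B → ℤ), (Pi.single T 1 - Pi.single T₁ 1 - Pi.single T₂ 1 + Pi.single T₃ 1 : Ty₂ B → ℤ) ∈ N →
        Shaped B N T) := by
  have pm1 : ∀ {k : ZMod 4}, (k = 1 ∨ k = -1) → k ≠ 0 ∧ k ≠ 2 := fun hk => by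
    rcases hk with rfl | rfl <;> exact ⟨by decide, by decide⟩
  have hlee2 : lee 2 = 2 := rfl
  have hlee1 : lee 1 = 1 := rfl
  have hleem1 : lee (-1) = 1 := rfl
  obtain ⟨s, t⟩ := T
  simp only [pot_mk] at hT ⊢
  by_cases h1 : ¬ IsRes B s
  · -- (1) oriented cross square in coordinate 0
    obtain ⟨u, p, q, hpq, hor, ⟨hp, up⟩, ⟨hq, uq⟩, ⟨hpq', upq⟩⟩ := exists_orientedSquare B h3 h1
    refine ⟨(QuarticTwist.flip B p s, t), (QuarticTwist.flip B q s, t), (QuarticTwist.flip B q (QuarticTwist.flip B p s), t),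
      Or.inl ⟨s, t, p, q, fun h => hpq (by rw [h]), (cface₀_eq B s t p q).symm⟩,
      ⟨by rw [pot_mk]; omega, by rw [pot_mk]; omega, by rw [pot_mk]; omega⟩,
      fun _ => ⟨u, p, q, hpq, (cface₀_eq B s t p q).symm, hor, ⟨hp, up⟩, ⟨hq, uq⟩, ⟨hpq', upq⟩⟩, fun h => absurd h h1, ?_, ?_⟩
    · intro u b k u' b' k' hT _ _
      exact absurd ⟨u, b, k, (Prod.ext_iff.mp hT).1⟩ h1
    · intro N hN
      rw [← cface₀_eq] at hN
      exact Or.inr (Or.inl ⟨u, p, q, hpq, hN, hor, ⟨hp, up⟩, ⟨hq, uq⟩, ⟨hpq', upq⟩⟩)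
  rw [not_not] at h1
  by_cases h2 : ∃ (u : ZMod 4) (b : B), s = atom B u b 2
  · -- (2) the column relation in coordinate 0 at a 2-atom
    obtain ⟨u, b, rfl⟩ := h2
    refine ⟨(atom B u b (-1), t), (atom B u b 1, t), (cst B u, t),
      Or.inl ⟨cst B u, t, (0, b), (1, b), fun h => zero_ne_one ((Prod.ext_iff.mp h).1 : (0 : ZMod 2) = 1), column_rel₀_eq B u b t⟩,
      ⟨?_, ?_, ?_⟩, fun h => absurd ⟨u, b, 2, rfl⟩ h, fun _ h => absurd ⟨u, b, rfl⟩ h, ?_, fun N hN => ?_⟩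
    · rw [pot_mk, Phi_atom B h3, Phi_atom B h3, hlee2, hleem1]; omega
    · rw [pot_mk, Phi_atom B h3, Phi_atom B h3, hlee2, hlee1]; omega
    · rw [pot_mk, Phi_atom B h3, Phi_cst B h3 u b, hlee2]; omega
    · intro u₁ b₁ k₁ u' b' k' hT hk _
      obtain ⟨-, -, h2k⟩ := (atom_eq_atom_iff B h3 (by decide : (2 : ZMod 4) ≠ 0)).mp (Prod.ext_iff.mp hT).1
      exact absurd h2k.symm (pm1 hk).2
    · exact Or.inr (Or.inr (Or.inr (Or.inl ⟨u, b, rfl, hN⟩)))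
  have hs1 : Phi B s ≤ 1 := Phi_le_one_of_isRes B h3 h1 h2
  by_cases h3' : ¬ IsRes B t
  · -- (3) oriented cross square in coordinate 1
    obtain ⟨u, p, q, hpq, hor, ⟨hp, up⟩, ⟨hq, uq⟩, ⟨hpq', upq⟩⟩ := exists_orientedSquare B h3 h3'
    refine ⟨(s, QuarticTwist.flip B p t), (s, QuarticTwist.flip B q t), (s, QuarticTwist.flip B q (QuarticTwist.flip B p t)),
      Or.inr (Or.inl ⟨s, t, p, q, fun h => hpq (by rw [h]), (cface₁_eq B s t p q).symm⟩),
      ⟨by rw [pot_mk]; omega, by rw [pot_mk]; omega, by rw [pot_mk]; omega⟩,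
      fun h => absurd h1 h, fun _ _ _ => ⟨u, p, q, hpq, (cface₁_eq B s t p q).symm, hor, ⟨hp, up⟩, ⟨hq, uq⟩, ⟨hpq', upq⟩⟩, ?_, ?_⟩
    · intro u b k u' b' k' hT _ _
      exact absurd ⟨u', b', k', (Prod.ext_iff.mp hT).2⟩ h3'
    · intro N hN
      rw [← cface₁_eq] at hN
      exact Or.inr (Or.inr (Or.inl ⟨u, p, q, hpq, hN, hor, ⟨hp, up⟩, ⟨hq, uq⟩, ⟨hpq', upq⟩⟩))
  rw [not_not] at h3'
  by_cases h4 : ∃ (u : ZMod 4) (b : B), t = atom B u b 2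
  · -- (4) the column relation in coordinate 1 at a 2-atom
    obtain ⟨u, b, rfl⟩ := h4
    refine ⟨(s, atom B u b (-1)), (s, atom B u b 1), (s, cst B u),
      Or.inr (Or.inl ⟨s, cst B u, (0, b), (1, b), fun h => zero_ne_one ((Prod.ext_iff.mp h).1 : (0 : ZMod 2) = 1),
        column_rel₁_eq B s u b⟩), ⟨?_, ?_, ?_⟩, fun h => absurd h1 h, fun _ _ h => absurd ⟨u, b, 2, rfl⟩ h, ?_, fun N hN => ?_⟩
    · rw [pot_mk, Phi_atom B h3 u b 2, Phi_atom B h3, hlee2, hleem1]; omega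
    · rw [pot_mk, Phi_atom B h3 u b 2, Phi_atom B h3, hlee2, hlee1]; omega
    · rw [pot_mk, Phi_atom B h3 u b 2, Phi_cst B h3 u b, hlee2]; omega
    · intro u₁ b₁ k₁ u' b' k' hT _ hk'
      obtain ⟨-, -, h2k⟩ := (atom_eq_atom_iff B h3 (by decide : (2 : ZMod 4) ≠ 0)).mp (Prod.ext_iff.mp hT).2
      exact absurd h2k.symm (pm1 hk').2
    · exact Or.inr (Or.inr (Or.inr (Or.inr ⟨u, b, rfl, hN⟩)))
  -- (5) the mixed square at a `(±atom, ±atom)` type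
  have ht1 : Phi B t ≤ 1 := Phi_le_one_of_isRes B h3 h3' h4
  obtain ⟨u, b, k, hk, rfl⟩ := exists_atom_of_Phi_eq_one B h3 h1 (by omega)
  obtain ⟨u', b', k', hk', rfl⟩ := exists_atom_of_Phi_eq_one B h3 h3' (by omega)
  refine ⟨(cst B u, atom B u' b' k'), (atom B u b k, cst B u'), (cst B u, cst B u'), ?_, ⟨?_, ?_, ?_⟩, fun h => absurd h1 h,
    fun _ _ h => absurd h3' h, ?_, fun N _ => Or.inl ⟨h1, h2, h3', h4⟩⟩
  · obtain ⟨j, hj⟩ := exists_flip_atom_eq_cst B u b hk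
    obtain ⟨j', hj'⟩ := exists_flip_atom_eq_cst B u' b' hk'
    refine Or.inr (Or.inr ⟨atom B u b k, atom B u' b' k', (j, b), (j', b'), ?_⟩)
    rw [hj, hj', tens_sub_sub, single_eq_tens, single_eq_tens, single_eq_tens, single_eq_tens]
  · rw [pot_mk, Phi_cst B h3 u b]; omega
  · rw [pot_mk, Phi_cst B h3 u' b']; omega
  · rw [pot_mk, Phi_cst B h3 u b, Phi_cst B h3 u' b']; omega
  · intro U V K U' V' K' hT _ _
    obtain ⟨hTs, hTt⟩ := Prod.ext_iff.mp hT
    obtain ⟨hu, hb, hkk⟩ := (atom_eq_atom_iff B h3 (pm1 hk).1).mp hTs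
    obtain ⟨hu', hb', hkk'⟩ := (atom_eq_atom_iff B h3 (pm1 hk').1).mp hTt
    subst hu hb hkk hu' hb' hkk'
    rw [tens_sub_sub, single_eq_tens, single_eq_tens, single_eq_tens, single_eq_tens]

end Summit.HodgeConjecture.CorCM.Census.OcticTwist
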